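import Summits.AtomisticToContinuum.FouriersLaw.Theorems.BondHeatUncertaintySubdiffusiveBondHeatKineticCorrectorBudget

/-!
# `KineticCorrectorBudget` — the bi-graded (time-horizon × anharmonicity-window) ladder  (lens-1 «grading», gen 54)

Node of the N_F branch (`FouriersLaw`), hanging UNDER the landed map file
`…Theorems.BondHeatUncertaintySubdiffusiveBondHeatKineticCorrectorBudget` (p840617; `KineticCorrectorBudget` = KCB,
IDEA-NEEDED · INSTRUMENTABLE, the "pure surplus" of the Thouless budget TB over the residual 11071).

PRESEARCH VERDICT (critic row 667 (2)): KCB is NOT in print.  Bernardin–Olla 2011 (arXiv:1105.0493) bound the Green–Kubo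
conductivity from ABOVE by an `H₋₁` variational formula (Prop. 4, p. 13) for the chain with velocity flips at EVERY site;
our `pinnedChain` has noise ONLY at sites `0` and `N − 1` (`OscillatorChain.generator`), and their bound degenerates as the
bulk flip rate `→ 0`.  The nearest print on OUR class is Lu 2026 (arXiv:2607.13953): `N`-uniform LSI / entropy decay for the
boundary-driven pinned chain under the perturbative assumption `N³·‖∇²W_N‖_∞ ≤ θ₀` (Assumption 2.2/2.5, Thm 2.4/2.6),
i.e. — through the tree's scaling conjugacy `Literature.Barriers.AtomisticToContinuum.lowTemperatureWeakAnharmonicity_holds`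
(`(q,p) ↦ √T·(x,v)` maps `(lam, β, T)` to `(T·lam, T·β, 1)`) — the LOW-TEMPERATURE WINDOW `T·N³ ≲ θ₀` of our chain
(modulo the unbounded quartic Hessian).  This file TYPES that window as a ladder and places KCB on it.

THE FUNCTIONAL. `correctorNormSq ω₂ lam β γ T N τ = ‖g^τ_{N,T}‖²_{L²(μ_T)}`, `g^τ = ∫₀^τ P_u θ₀ du`, `θ₀ = p₀² − T`
(VERBATIM the `dite` body of KCB; `kineticCorrectorBudget_iff` is `Iff.rfl`).  Under the conjugacy
`‖g^τ_{N,T}‖² = T²·‖g'^τ_{N,1}‖²` (primed = chain `(T·lam, T·β)`), whence the budget `C·N·T²` below.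

THE LADDER (two real parameters; larger `α` and smaller `s` = WEAKER):
* `HorizonCorrectorBudget s`   — fixed `T`, only `τ ≤ N^s`:           `sup_{τ ≤ N^s} ‖g^τ‖² ≤ C_T·N`.
* `WindowedCorrectorBudget α`  — all `τ`, only `T·N^α ≤ θ`:           `‖g^τ_{N,T}‖² ≤ C·N·T²` (C, N₀ UNIFORM in the window).
* `BigradedCorrectorBudget s α` — both restrictions.
* `AffineCorrectorCeiling`     — the FREE rung `‖g^τ_{N,T}‖² ≤ (2T²/γ)·τ + B_T` for all `N, τ` (Jensen for the path law +
  the landed `pinnedChain_timeIntegral_sq` + the landed bath-bond reduction lower bound `W_N ≥ −2E[e₀²]/(γT²)`;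
  ATTACKABLE·S, not proved here); `CovariantCorrectorCeiling` — the same with `B_T = b·T²` (T-uniform statics; ATTACKABLE·M).

SEAMS (all sorry-free, pure bookkeeping): `kineticCorrectorBudget_iff`; `horizonCorrectorBudget_of_kcb` (KCB ⟹ every
horizon rung); `kcb_of_windowedCorrectorBudget_neg` (a window with `α < 0` ⟹ KCB: the ladder passes THROUGH KCB);
monotonicity `horizonCorrectorBudget_mono`, `windowedCorrectorBudget_mono`, `bigradedCorrectorBudget_mono`;
`bigradedCorrectorBudget_of_windowed`, `bigradedCorrectorBudget_of_horizon_of_nonpos`;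
`affineCorrectorCeiling_of_covariant`, `horizonCorrectorBudget_one_of_affineCeiling`,
`bigradedCorrectorBudget_one_of_covariantCeiling`, `…_of_le_one` (the free rungs fill the whole strip `s ≤ 1`).

MAP OF THE (s, α) PLANE (tags; exponent counts are HEURISTIC bookkeeping, not theorems):
* `s ≤ 1`, every `α`                — FREE (= `AffineCorrectorCeiling` at fixed `T`, ATTACKABLE·S from landed pieces;
  uniformly in the window = `CovariantCorrectorCeiling`, ATTACKABLE·M).
* `α ≥ 3`, every `s` (incl. `s = ∞`) — ATTACKABLE·L: PERTURBATIVE ABOUT PHONONS on the Becker–Menegaki `N³` relaxation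
  scale [Lu 2026 §3–4: uniform `L²(dt)` bound for the linearised boundary-damped harmonic propagator + Gaussian
  comparison], to be adapted from the NESS law to the EQUILIBRIUM corrector and supplemented by a Gibbs-tail truncation for
  the quartic Hessian (expect a `log N` loss: `α > 3` safe, `α = 3` UNDECIDED).
* `1 < s < 3`, `α ≥ 2s` (crude pathwise Gronwall over the horizon `N^s` with common noise) resp. conjecturally `α ≥ s`
  (square-function version of Lu's estimate)  — ATTACKABLE·M.
* `1 < s`, `α < min(s, 3)`            — IDEA-NEEDED: below the perturbative window; NO print (presearch above).  This
  region contains the Thouless cell `(s, α) = (2, 0)` (= KCB^{(2)}, the corrector at TB's time `cN²`, fixed `T`) and the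
  corner KCB = `(∞, fixed T)`.  THE N_F IDEA-NEEDED LINE, quantitatively: «push the window exponent below `α = 3` at
  `s = ∞`, or below `α = s` on the diagonal» — every such rung is a statement about BOUNDARY-ONLY noise at an
  anharmonicity LARGER than the inverse harmonic relaxation time.
* `α < 0`                              — STRONGER than KCB (uniformity towards HIGH temperature / strong anharmonicity);
  off-path, UNDECIDED, recorded only because `kcb_of_windowedCorrectorBudget_neg` makes the ladder pass through KCB.

REGIME-UNIFORMITY CLASSIFICATION (why this ladder is filed for KCB and NOT for the residual): an N_F statement admits a
weak-anharmonicity ladder iff it is TRUE AT THE HARMONIC MEMBER.  Phonon-true: KCB (`≤ T²N/(2γ²)`, g53), `TransientBudget`,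
(K) 9121, the two ceilings.  Phonon-false (ballistic `E_N → 1/8`, tree `HarmonicChainBallisticFlux_holds`):
11071 `BoundedResponse`, `ThoulessBudget`, (S) 9120, `FouriersLaw` — for these every window rung with `α` large is
FALSE (perturbation preserves `E_N ≈ 1/8` along `T·N^α ≤ θ`, `α > 3`), so NO weak-anharmonicity ladder exists for the
residual; its only corner ladder is the kinetic limit (route `KineticCorner`, items 3430/3431).

WHY EVERY PIECE IS STRICTLY WEAKER THAN ITS PARENT (phonon / scaling witnesses): `Horizon s` drops all `τ > N^s`
(KCB ⟹ Horizon s, converse open: the constants `C_s` may blow up as `s → ∞`); `Windowed α ⟹ Windowed α'` for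
`α ≤ α'` drops chains; `Bigraded` drops both; the ceilings are implied by nothing above and imply only the
strip `s ≤ 1`.  Nothing here is on the `FouriersLaw` cone except through KCB → TCI → ContactOhmicFloor (g53's
`fouriersLaw_of_kcb`): the ladder grades the INSTRUMENT, the residual 11071 stays load-bearing.
No item is closed here.  Tags: [piece · rung] on the four `Prop`s, [folklore] on the seams.
-/

noncomputable section

open MeasureTheory Filter Topology Set
open Literature.MathematicalPhysics.KineticTheory.HeatConduction

namespace Summit.AtomisticToContinuum.FouriersLaw.Theorems.SubdiffusiveBondHeat.CorrectorBudget

namespace Ladder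

/-! ## The functional and the verbatim bridge to KCB -/

/-- `‖g^τ_{N,T}‖²_{L²(μ_T)}` with `g^τ(z) = ∫₀^τ ∫ (p₀² − T) dκ_u(z,·) du` — VERBATIM the `dite` of `KineticCorrectorBudget`
(value `0` at `N = 0`). -/
def correctorNormSq (ω₂ lam β γ T : ℝ) (N : ℕ) (τ : ℝ) : ℝ :=
  if h : 0 < N then
    ∫ z, (∫ u in (0 : ℝ)..τ, ∫ y, ((y.2 ⟨0, h⟩) ^ 2 - T)
        ∂((pinnedChain ω₂ lam β γ).transitionKernel N T T u.toNNReal z)) ^ 2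
      ∂((pinnedChain ω₂ lam β γ).gibbsMeasure N T)
  else 0

/-- KCB in the functional's spelling — definitionally. [folklore] -/
theorem kineticCorrectorBudget_iff :
    KineticCorrectorBudget ↔
      ∀ ω₂ lam β γ : ℝ, 0 < ω₂ → 0 < lam → 0 < β → 0 < γ → ∀ T : ℝ, 0 < T →
        ∃ C : ℝ, ∃ N₀ : ℕ, ∀ N : ℕ, N₀ ≤ N → ∀ τ : ℝ, 0 ≤ τ →
          correctorNormSq ω₂ lam β γ T N τ ≤ C * (N : ℝ) :=
  Iff.rfl

/-! ## The rungs -/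

/-- **Horizon rung** `KCB^{(s)}` (fixed temperature, time horizon `N^s`):
`∀ T > 0 ∃ C N₀ ∀ N ≥ N₀ ∀ τ ∈ [0, N^s], ‖g^τ_{N,T}‖² ≤ C·N`.
Tags: `s ≤ 1` FREE (see `AffineCorrectorCeiling`); `1 < s` IDEA-NEEDED at fixed `T` (the Thouless cell is `s = 2`);
KCB is the `s = ∞` corner (`horizonCorrectorBudget_of_kcb`).  INSTRUMENTABLE: `sup_{τ ≤ N^s} ‖g^τ‖²/N` by the census
two-replica estimator (row 667 (3)). [piece · rung] -/
def HorizonCorrectorBudget (s : ℝ) : Prop :=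
  ∀ ω₂ lam β γ : ℝ, 0 < ω₂ → 0 < lam → 0 < β → 0 < γ → ∀ T : ℝ, 0 < T →
    ∃ C : ℝ, ∃ N₀ : ℕ, ∀ N : ℕ, N₀ ≤ N → ∀ τ : ℝ, 0 ≤ τ → τ ≤ (N : ℝ) ^ s →
      correctorNormSq ω₂ lam β γ T N τ ≤ C * (N : ℝ)

/-- **Window rung** `KCB_{[α]}` (all times, low-temperature = weak-anharmonicity window `T·N^α ≤ θ`, constants UNIFORM in
the window, budget in the scaling-covariant form `C·N·T²`):
`∃ θ > 0 ∃ C N₀ ∀ N ≥ N₀ ∀ T > 0, T·N^α ≤ θ → ∀ τ ≥ 0, ‖g^τ_{N,T}‖² ≤ C·N·T²`.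
Tags: `α > 3` ATTACKABLE·L (perturbative about phonons on the `N³` scale, Lu 2026 §3–4 + Gibbs-tail truncation);
`α = 3` UNDECIDED (log loss); `0 ≤ α < 3` IDEA-NEEDED (below the perturbative window — THE N_F idea-needed line);
`α < 0` STRONGER than KCB (`kcb_of_windowedCorrectorBudget_neg`), off-path. [piece · rung] -/
def WindowedCorrectorBudget (α : ℝ) : Prop :=
  ∀ ω₂ lam β γ : ℝ, 0 < ω₂ → 0 < lam → 0 < β → 0 < γ →
    ∃ θ : ℝ, 0 < θ ∧ ∃ C : ℝ, ∃ N₀ : ℕ, ∀ N : ℕ, N₀ ≤ N → ∀ T : ℝ, 0 < T → T * (N : ℝ) ^ α ≤ θ →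
      ∀ τ : ℝ, 0 ≤ τ → correctorNormSq ω₂ lam β γ T N τ ≤ C * (N : ℝ) * T ^ 2

/-- **Bi-graded rung** `KCB^{(s)}_{[α]}` (horizon `N^s` AND window `T·N^α ≤ θ`).
Tags: `s ≤ 1` FREE; `α ≥ 2s` (`1 < s ≤ 3/2`) ATTACKABLE·M by crude pathwise Gronwall about the harmonic flow with common
noise, conjecturally `α ≥ min(s,3)`; `1 < s ∧ α < min(s,3)` IDEA-NEEDED. [piece · rung] -/
def BigradedCorrectorBudget (s α : ℝ) : Prop :=
  ∀ ω₂ lam β γ : ℝ, 0 < ω₂ → 0 < lam → 0 < β → 0 < γ →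
    ∃ θ : ℝ, 0 < θ ∧ ∃ C : ℝ, ∃ N₀ : ℕ, ∀ N : ℕ, N₀ ≤ N → ∀ T : ℝ, 0 < T → T * (N : ℝ) ^ α ≤ θ →
      ∀ τ : ℝ, 0 ≤ τ → τ ≤ (N : ℝ) ^ s → correctorNormSq ω₂ lam β γ T N τ ≤ C * (N : ℝ) * T ^ 2

/-- **The free affine ceiling** (support; ATTACKABLE·S from LANDED pieces, not proved here): at fixed `T`,
`‖g^τ_{N,T}‖² ≤ (2T²/γ)·τ + B_T` for EVERY `N` and `τ ≥ 0`.  Route: Jensen for the path law `(E_z X)² ≤ E_z X²`,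
`X = ∫₀^τ θ₀(Z_u)du`; the landed `pinnedChain_timeIntegral_sq` + triangle identity
`E_{μ_T⊗W}[X²] = 2∫₀^τ(τ − r)K_N(r)dr = (2T²/γ)(τ − W_N(τ))`, `W_N(τ) = ∫₀^τ(1 − θ_N)`; and `W_N(τ) ≥ −2E[e₀²]/(γT²)` from the
landed bath-bond reduction `0 ≤ V_N(0,τ) ≤ 4γT²W_N(τ) + 8E[e₀²]` with the `N`-uniform statics `E[e₀²] ≤ σ²`
(`localEnergyMoment`): `B_T = 4σ²/γ²`.  Phonons: `‖g^τ‖² → T²N/(2γ²)` (saturation at `τ ≍ N`). [piece · support] -/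
def AffineCorrectorCeiling : Prop :=
  ∀ ω₂ lam β γ : ℝ, 0 < ω₂ → 0 < lam → 0 < β → 0 < γ → ∀ T : ℝ, 0 < T →
    ∃ B : ℝ, ∀ N : ℕ, ∀ τ : ℝ, 0 ≤ τ → correctorNormSq ω₂ lam β γ T N τ ≤ 2 * T ^ 2 / γ * τ + B

/-- **The scaling-covariant affine ceiling** (support; ATTACKABLE·M): `∃ b ∀ T > 0, ‖g^τ_{N,T}‖² ≤ (2T²/γ)·τ + b·T²` — the same
route plus the `T`-UNIFORM statics `E_{μ_T}[e₀²] ≤ (bγ²/4)·T²` for all `T > 0` (by the conjugacy: a bound on `E_{μ_1}[e₀²]`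
uniform over the chains `(T·lam, T·β)`, `T ∈ (0,∞)` — virial identity `E[q₀ ∂_{q₀}H] = 1` + even convex moment comparison;
not landed in this uniform form). [piece · support] -/
def CovariantCorrectorCeiling : Prop :=
  ∀ ω₂ lam β γ : ℝ, 0 < ω₂ → 0 < lam → 0 < β → 0 < γ →
    ∃ b : ℝ, ∀ T : ℝ, 0 < T → ∀ N : ℕ, ∀ τ : ℝ, 0 ≤ τ →
      correctorNormSq ω₂ lam β γ T N τ ≤ 2 * T ^ 2 / γ * τ + b * T ^ 2

/-! ## Seams: KCB on the ladder -/

/-- KCB ⟹ every horizon rung (drop the horizon). [folklore] -/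
theorem horizonCorrectorBudget_of_kcb (hK : KineticCorrectorBudget) (s : ℝ) : HorizonCorrectorBudget s := by
  intro ω₂ lam β γ hω hl hβ hγ T hT
  obtain ⟨C, N₀, hC⟩ := hK ω₂ lam β γ hω hl hβ hγ T hT
  exact ⟨C, N₀, fun N hN τ hτ _ => hC N hN τ hτ⟩

/-- A window with NEGATIVE exponent eventually contains every fixed temperature, so it implies KCB (with `C_T = C·T²`):
the ladder `α ↦ WindowedCorrectorBudget α` passes through KCB between `α < 0` and `α ≥ 0`. [folklore] -/
theorem kcb_of_windowedCorrectorBudget_neg {α : ℝ} (hα : α < 0) (hW : WindowedCorrectorBudget α) :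
    KineticCorrectorBudget := by
  intro ω₂ lam β γ hω hl hβ hγ T hT
  obtain ⟨θ, hθ, C, N₀, hC⟩ := hW ω₂ lam β γ hω hl hβ hγ
  -- `N^α → 0`, hence eventually `T·N^α ≤ θ`
  have hlim : Tendsto (fun N : ℕ => T * (N : ℝ) ^ α) atTop (𝓝 (T * 0)) := by
    refine Tendsto.const_mul T ?_
    have h1 : Tendsto (fun x : ℝ => x ^ α) atTop (𝓝 0) := by
      have := tendsto_rpow_neg_atTop (y := -α) (by linarith)
      simpa using this
    exact h1.comp tendsto_natCast_atTop_atTop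
  rw [mul_zero] at hlim
  have hev : ∀ᶠ N : ℕ in atTop, T * (N : ℝ) ^ α ≤ θ :=
    (hlim.eventually (Iic_mem_nhds hθ)).mono fun N hN => hN
  obtain ⟨N₁, hN₁⟩ := eventually_atTop.1 hev
  refine ⟨C * T ^ 2, max N₀ N₁, fun N hN τ hτ => ?_⟩
  have h := hC N (le_trans (le_max_left _ _) hN) T hT (hN₁ N (le_trans (le_max_right _ _) hN)) τ hτ
  calc correctorNormSq ω₂ lam β γ T N τ ≤ C * (N : ℝ) * T ^ 2 := h
    _ = C * T ^ 2 * (N : ℝ) := by ring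

/-! ## Seams: monotonicity along the two gradings -/

/-- Shrinking the horizon weakens: `s' ≤ s → KCB^{(s)} → KCB^{(s')}`. [folklore] -/
theorem horizonCorrectorBudget_mono {s s' : ℝ} (hs : s' ≤ s) (h : HorizonCorrectorBudget s) :
    HorizonCorrectorBudget s' := by
  intro ω₂ lam β γ hω hl hβ hγ T hT
  obtain ⟨C, N₀, hC⟩ := h ω₂ lam β γ hω hl hβ hγ T hT
  refine ⟨C, max N₀ 1, fun N hN τ hτ hτs => hC N (le_trans (le_max_left _ _) hN) τ hτ ?_⟩
  have hN1 : (1 : ℝ) ≤ (N : ℝ) := by exact_mod_cast le_trans (le_max_right _ _) hN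
  exact hτs.trans (Real.rpow_le_rpow_of_exponent_le hN1 hs)

/-- Shrinking the window weakens: `α ≤ α' → KCB_{[α]} → KCB_{[α']}`. [folklore] -/
theorem windowedCorrectorBudget_mono {α α' : ℝ} (hα : α ≤ α') (h : WindowedCorrectorBudget α) :
    WindowedCorrectorBudget α' := by
  intro ω₂ lam β γ hω hl hβ hγ
  obtain ⟨θ, hθ, C, N₀, hC⟩ := h ω₂ lam β γ hω hl hβ hγ
  refine ⟨θ, hθ, C, max N₀ 1, fun N hN T hT hw τ hτ => hC N (le_trans (le_max_left _ _) hN) T hT ?_ τ hτ⟩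
  have hN1 : (1 : ℝ) ≤ (N : ℝ) := by exact_mod_cast le_trans (le_max_right _ _) hN
  exact le_trans (mul_le_mul_of_nonneg_left (Real.rpow_le_rpow_of_exponent_le hN1 hα) hT.le) hw

/-- Both gradings at once: `s' ≤ s → α ≤ α' → KCB^{(s)}_{[α]} → KCB^{(s')}_{[α']}`. [folklore] -/
theorem bigradedCorrectorBudget_mono {s s' α α' : ℝ} (hs : s' ≤ s) (hα : α ≤ α')
    (h : BigradedCorrectorBudget s α) : BigradedCorrectorBudget s' α' := by
  intro ω₂ lam β γ hω hl hβ hγ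
  obtain ⟨θ, hθ, C, N₀, hC⟩ := h ω₂ lam β γ hω hl hβ hγ
  refine ⟨θ, hθ, C, max N₀ 1, fun N hN T hT hw τ hτ hτs => hC N (le_trans (le_max_left _ _) hN) T hT ?_ τ hτ ?_⟩
  · have hN1 : (1 : ℝ) ≤ (N : ℝ) := by exact_mod_cast le_trans (le_max_right _ _) hN
    exact le_trans (mul_le_mul_of_nonneg_left (Real.rpow_le_rpow_of_exponent_le hN1 hα) hT.le) hw
  · have hN1 : (1 : ℝ) ≤ (N : ℝ) := by exact_mod_cast le_trans (le_max_right _ _) hN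
    exact hτs.trans (Real.rpow_le_rpow_of_exponent_le hN1 hs)

/-- A window rung gives every bi-graded rung of the same window. [folklore] -/
theorem bigradedCorrectorBudget_of_windowed {α : ℝ} (h : WindowedCorrectorBudget α) (s : ℝ) :
    BigradedCorrectorBudget s α := by
  intro ω₂ lam β γ hω hl hβ hγ
  obtain ⟨θ, hθ, C, N₀, hC⟩ := h ω₂ lam β γ hω hl hβ hγ
  exact ⟨θ, hθ, C, N₀, fun N hN T hT hw τ hτ _ => hC N hN T hT hw τ hτ⟩

/-! ## Seams: the free strip `s ≤ 1` -/

/-- The covariant ceiling is the affine one with `B_T = b·T²`. [folklore] -/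
theorem affineCorrectorCeiling_of_covariant (hL : CovariantCorrectorCeiling) : AffineCorrectorCeiling := by
  intro ω₂ lam β γ hω hl hβ hγ T hT
  obtain ⟨b, hb⟩ := hL ω₂ lam β γ hω hl hβ hγ
  exact ⟨b * T ^ 2, fun N τ hτ => hb T hT N τ hτ⟩

/-- The free affine ceiling fills the horizon rung `s = 1` at every fixed temperature
(`C_T = 2T²/γ + max B_T 0`, `N₀ = 1`). [folklore] -/
theorem horizonCorrectorBudget_one_of_affineCeiling (hL : AffineCorrectorCeiling) : HorizonCorrectorBudget 1 := by
  intro ω₂ lam β γ hω hl hβ hγ T hT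
  obtain ⟨B, hB⟩ := hL ω₂ lam β γ hω hl hβ hγ T hT
  refine ⟨2 * T ^ 2 / γ + max B 0, 1, fun N hN τ hτ hτs => ?_⟩
  have h := hB N τ hτ
  have hc : 0 ≤ 2 * T ^ 2 / γ := by positivity
  have hN1 : (1 : ℝ) ≤ (N : ℝ) := by exact_mod_cast hN
  have hτN : τ ≤ (N : ℝ) := by simpa [Real.rpow_one] using hτs
  have h1 : 2 * T ^ 2 / γ * τ ≤ 2 * T ^ 2 / γ * (N : ℝ) := mul_le_mul_of_nonneg_left hτN hc
  have h2 : B ≤ max B 0 * (N : ℝ) := (le_max_left B 0).trans (le_mul_of_one_le_right (le_max_right B 0) hN1)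
  calc correctorNormSq ω₂ lam β γ T N τ ≤ 2 * T ^ 2 / γ * τ + B := h
    _ ≤ 2 * T ^ 2 / γ * (N : ℝ) + max B 0 * (N : ℝ) := add_le_add h1 h2
    _ = (2 * T ^ 2 / γ + max B 0) * (N : ℝ) := by ring

/-- … and the COVARIANT ceiling fills the whole bi-graded strip `s = 1` uniformly in every window
(`θ` arbitrary, `C = 2/γ + max b 0`, `N₀ = 1`).  Hence by monotonicity every cell with `s ≤ 1`. [folklore] -/
theorem bigradedCorrectorBudget_one_of_covariantCeiling (hL : CovariantCorrectorCeiling) (α : ℝ) :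
    BigradedCorrectorBudget 1 α := by
  intro ω₂ lam β γ hω hl hβ hγ
  obtain ⟨b, hb⟩ := hL ω₂ lam β γ hω hl hβ hγ
  refine ⟨1, one_pos, 2 / γ + max b 0, 1, fun N hN T hT _ τ hτ hτs => ?_⟩
  have h := hb T hT N τ hτ
  have hc : 0 ≤ 2 * T ^ 2 / γ := by positivity
  have hN1 : (1 : ℝ) ≤ (N : ℝ) := by exact_mod_cast hN
  have hτN : τ ≤ (N : ℝ) := by simpa [Real.rpow_one] using hτs
  have hT2 : 0 ≤ T ^ 2 := sq_nonneg T
  have h1 : 2 * T ^ 2 / γ * τ ≤ 2 * T ^ 2 / γ * (N : ℝ) := mul_le_mul_of_nonneg_left hτN hc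
  have h2 : b * T ^ 2 ≤ max b 0 * T ^ 2 * (N : ℝ) :=
    (mul_le_mul_of_nonneg_right (le_max_left b 0) hT2).trans
      (le_mul_of_one_le_right (mul_nonneg (le_max_right b 0) hT2) hN1)
  calc correctorNormSq ω₂ lam β γ T N τ ≤ 2 * T ^ 2 / γ * τ + b * T ^ 2 := h
    _ ≤ 2 * T ^ 2 / γ * (N : ℝ) + max b 0 * T ^ 2 * (N : ℝ) := add_le_add h1 h2
    _ = (2 / γ + max b 0) * (N : ℝ) * T ^ 2 := by ring

/-- The free strip, stated once: `CovariantCorrectorCeiling → s ≤ 1 → KCB^{(s)}_{[α]}` for every `α`. [folklore] -/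
theorem bigradedCorrectorBudget_of_covariantCeiling_of_le_one (hL : CovariantCorrectorCeiling) {s : ℝ} (hs : s ≤ 1)
    (α : ℝ) : BigradedCorrectorBudget s α :=
  bigradedCorrectorBudget_mono hs le_rfl (bigradedCorrectorBudget_one_of_covariantCeiling hL α)

/-- … and `AffineCorrectorCeiling → s ≤ 1 → KCB^{(s)}` at fixed temperature. [folklore] -/
theorem horizonCorrectorBudget_of_affineCeiling_of_le_one (hL : AffineCorrectorCeiling) {s : ℝ} (hs : s ≤ 1) :
    HorizonCorrectorBudget s :=
  horizonCorrectorBudget_mono hs (horizonCorrectorBudget_one_of_affineCeiling hL)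

/-! ## Seam: KCB in the functional's spelling, pointwise in `T` -/

/-- KCB gives, for each fixed `T`, the window-free, horizon-free budget `C_T·N` (its constant may depend on `T`; NO seam
`KCB → WindowedCorrectorBudget α` for `α ≥ 0` is claimed — the window rungs ask for `C`, `N₀` UNIFORM in `T`). [folklore] -/
theorem correctorNormSq_le_of_kcb (hK : KineticCorrectorBudget) {ω₂ lam β γ : ℝ} (hω : 0 < ω₂) (hl : 0 < lam)
    (hβ : 0 < β) (hγ : 0 < γ) {T : ℝ} (hT : 0 < T) :
    ∃ C : ℝ, ∃ N₀ : ℕ, ∀ N : ℕ, N₀ ≤ N → ∀ τ : ℝ, 0 ≤ τ → correctorNormSq ω₂ lam β γ T N τ ≤ C * (N : ℝ) :=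
  hK ω₂ lam β γ hω hl hβ hγ T hT

end Ladder

end Summit.AtomisticToContinuum.FouriersLaw.Theorems.SubdiffusiveBondHeat.CorrectorBudget

end
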